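import Literature.AlgebraicGeometry.HodgeTheory.AbelianVarietyCyclotomicAutomorphismMultiplicities
import Mathlib.RingTheory.Polynomial.Cyclotomic.Roots
import Mathlib.RingTheory.PowerBasis
import Mathlib.Analysis.Complex.Basic
import HarnessLib

/-!
# Zarhin's formula `𝐚(v) = ((p−1)/p) · (𝐛 ∗ 𝐣)(−v) − 1`: the multiplicity function of a prime-order automorphism
# from the rotation numbers at the fixed points (the cyclotomic inversion of the holomorphic Lefschetz identity)

Family `hodge`, lane `lit-hodgefound` (seat p03, GEN 35 «the analytic type of a finite-order automorphism», row g35-#6; sequel of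
g35-#1 `AbelianVarietyCyclotomicAutomorphismMultiplicities`), topic `Literature/AlgebraicGeometry/HodgeTheory`.
Theorems only: no definition, no instance, no named fact (net Literature debt 0).

Zarhin's Theorem 1.4 says which admissible functions `𝐚 : G = (ℤ/pℤ)^* → ℤ_+` arise from a Jacobian `(J(C), Θ)` with an
automorphism `δ` of prime order `p`: writing `𝐛(h)` for the number of fixed points `P` of the curve automorphism `φ` inducing
`δ` whose rotation number is `ε_P = ζ_p^h`, one has `𝐚(v) = ((p−1)/p) · (𝐛 ∗ 𝐣)(−v) − 1` (Proposition 1.11), where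
`𝐣(j mod p) = j ∈ {1, …, p−1}` and `(f₁ ∗ f₂)(h) = (1/(p−1)) Σ_{u ∈ G} f₁(u) f₂(u⁻¹ h)`.  The GEOMETRIC inputs of the proof
are the holomorphic Lefschetz fixed-point formula `1 − τ̄ = Σ_{P ∈ B} 1/(1 − ε_P)` (with `τ = Tr(φ^* | Ω¹(C)) = Tr(δ^* | Ω¹(J))`,
Lemma 1.9) and Riemann–Hurwitz; the DEDUCTION from the Lefschetz identity to the formula is pure cyclotomic algebra
(Lemma 1.10 `1/(1−ζ) = −(Σ_{j=1}^{p−1} j ζ^j)/p`, the substitution `v = hu`, `1 = −Σ_{v ∈ G} ζ_p^v`, and the fact that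
`{ζ_p^v | v ∈ G}` is a `ℚ`-basis of `ℚ(ζ_p)`).  This file formalizes that deduction for an ARBITRARY pair of rational-valued
functions `𝐚, 𝐛` on `G` bound by the Lefschetz identity (§3), and specialises it to the tree's multiplicity function
`h ↦ n_{ζ^h}(δ)` of an endomorphism `δ` with `Φ_p(δ) = 0` of a complex abelian variety (§4): GIVEN the Lefschetz identity for
`τ = Tr_a(δ)`, the analytic type of `δ` is Zarhin's convolution of the rotation-number count `𝐛`.  As a by-product the
count is forced: `Σ_h 𝐛(h) = 𝐚(v) + 𝐚(−v) + 2` (`= 2g/(p−1) + 2`, Corollary 1.8, which Zarhin gets from Riemann–Hurwitz;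
Remark 1.12 runs this consistency check in the other direction).

## Sources, verbatim (held text `paper:arxiv-2109.06794`)

Yu. G. Zarhin, *Jacobians with automorphisms of prime order*, Math. Research Reports (2021) = arXiv:2109.06794, §1:
(chunk p0003 L106–L121) «the function `𝐣 : G = (ℤ/pℤ)^* → ℤ`, `(j mod p) ↦ j` (`1 ≤ j ≤ p−1`) […] convolution
`f₁ ∗ f₂(h) = (1/(p−1)) Σ_{u∈G} f₁(u) f₂(u⁻¹h)`»; (L131–L147) «**Theorem 1.4.** Suppose that `(X, λ)` is the jacobian of a
smooth projective irreducible genus `g` curve `𝒞` with canonical principal polarization. Then there exists a nonnegative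
integer-valued function `𝐛 : G → ℤ_+` such that `Σ_{h∈G} 𝐛(h) = 2g/(p−1) + 2`, `𝐚(v) = ((p−1)/p) · 𝐛 ∗ 𝐣(−v) − 1 ∀ v ∈ G`»;
(chunk p0004 L44–L52) «**Corollary 1.8.** The number `F(φ)` of fixed points of `φ` is `2g/(p−1) + 2`. Proof. Applying the
Riemann–Hurwitz's formula to `𝒞 → D`, we get `2g − 2 = p·(−2) + (p−1)·F(φ)`»; (L55–L60) «**Lemma 1.9.** […] `τ` the trace of
`φ^*`. Then `τ = Σ_{j=1}^{p-1} a_j ζ_p^j = Σ_{h∈G} 𝐚(h) ζ_p^h`»; (L82–L95) «**Lemma 1.10.** Let `ζ ∈ ℂ` be a primitive `p`th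
root of unity. Then `1/(1−ζ) = −(Σ_{j=1}^{p−1} j ζ^j)/p = −(Σ_{h∈G} 𝐣(h) ζ^h)/p`. Proof. We have
`(1−ζ)(Σ_{j=1}^{p−1} j ζ^j) = Σ_{j=1}^{p−1} (j ζ^j − j ζ^{j+1}) = (Σ_{j=1}^{p−1} ζ^j) − (p−1)ζ^p = (−1) − (p−1) = −p`»;
(L97–L105) «By the holomorphic Lefschetz fixed point formula [AT], [GH] applied to `φ`, `1 − τ̄ = Σ_{P∈B} 1/(1 − ε_P)`
where `τ̄` is the complex-conjugate of `τ`. Recall that every `ε_P` is a (primitive) `p`th root of unity»; (L113–L121)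
«**Proposition 1.11.** Let us define for each `h ∈ G` the nonnegative integer `𝐛(h)` as the number of fixed points `P ∈ B`
such that `ε_P = ζ_p^h`. Then `Σ_{h∈G} 𝐛(h) = F(φ) = 2g/(p−1) + 2` and `𝐚(v) = ((p−1)/p) · 𝐛 ∗ 𝐣(−v) − 1 ∀ v ∈ G`»;
(L131–L160, the proof) «`1 − Σ_{h∈G} 𝐚(h) ζ_p^{−h} = Σ_{u∈G} 𝐛(u) · 1/(1 − ζ_p^u) = (−1/p)(Σ_{u∈G} 𝐛(u)(Σ_{h∈G} 𝐣(h) ζ_p^{hu}))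
= (−1/p) Σ_{v∈G} (Σ_{u∈G} 𝐛(u) 𝐣(u⁻¹v)) ζ_p^v = (−1/p) Σ_{v∈G} 𝐛 ∗ 𝐣(v) ζ_p^v` (here we use a substitution `v = hu`). Taking
into account that `0 = 1 + Σ_{j=1}^{p−1} ζ_p^j = 1 + Σ_{v∈G} ζ_p^v`, we obtain […] Taking into account that the `(p−1)`-element set
`{ζ_p^j | 1 ≤ j ≤ p−1} = {ζ_p^v | v ∈ G}` is a basis of the `ℚ`-vector space `ℚ(ζ_p)`, we get `1 + 𝐚(−v) = (p−1) 𝐛 ∗ 𝐣(v)/p`»;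
(chunk p0005 L1–L35, Remark 1.12) «This implies that `𝐚(v) + 𝐚(−v) = 2g/(p−1)`. (Actually, we already know it, see (1.3).)».
The `ℚ`-basis fact is `[ℚ(ζ_p) : ℚ] = deg Φ_p = p − 1`, i.e. `Φ_p = minpoly_ℚ(ζ_p)` (Mathlib `cyclotomic_eq_minpoly_rat`,
`linearIndependent_pow`); the holomorphic Lefschetz formula is Zarhin's [AT] = Atiyah–Bott, [GH] = Griffiths–Harris
(chunk p0008 L5–L9) and enters here only as the hypothesis `hL`.

## What is proved

Namespace `Literature.AlgebraicGeometry.HodgeTheory.PrimeOrderRotation` (pure cyclotomic algebra; `K` a field, `p` prime,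
`ζ` a primitive `p`-th root of unity in `K`, `G = (ZMod p)ˣ`, `ζ^v := ζ ^ (v : ZMod p).val`):
* §1 LEMMA 1.10: `one_sub_mul_sum_range_natCast_mul_pow` (`(1 − ζ) Σ_{j<n} j ζ^j = −n` for `ζ^n = 1`, `ζ ≠ 1`),
  **`inv_one_sub_eq_neg_sum_div`** (`1/(1−ζ) = −(Σ_{j<n} j ζ^j)/n`).
* §2 THE GROUP `G = (ℤ/pℤ)^*` AS INDEX SET: `pow_val_mul` (`ζ^{uv} = (ζ^u)^{𝐣(v)}`), `pow_val_neg` (`ζ^{−v} = (ζ^v)⁻¹`),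
  `isPrimitiveRoot_pow_val`, `pow_val_ne_one`, **`sum_units_eq_sum_Ico`** (`Σ_{v∈G} f(𝐣 v) = Σ_{j=1}^{p−1} f(j)`),
  `sum_pow_val_eq_neg_one` (`Σ_{v∈G} ζ^v = −1`), **`eq_zero_of_sum_ratCast_mul_pow_val_eq_zero`** (`{ζ^v}_{v∈G}` is
  `ℚ`-linearly independent: `Σ_v c_v ζ^v = 0`, `c_v ∈ ℚ` ⇒ `c = 0`).
* §3 PROPOSITION 1.11, THE DEDUCTION: **`prime_mul_add_one_eq_sum_of_lefschetz`** — for `𝐚, 𝐛 : G → ℚ` with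
  `1 − Σ_h 𝐚(h) ζ^{−h} = Σ_u 𝐛(u)/(1 − ζ^u)`: `p · (𝐚(v) + 1) = Σ_{u∈G} 𝐛(u) 𝐣(u⁻¹(−v))` for every `v ∈ G`; the printed form
  **`eq_convolution_sub_one_of_lefschetz`** (`𝐚(v) = ((p−1)/p) · ((1/(p−1)) Σ_u 𝐛(u) 𝐣(u⁻¹(−v))) − 1`); the `ℕ`-valued form
  `prime_mul_add_one_eq_sum_of_lefschetz_nat`; and the forced count **`sum_eq_add_add_two_of_lefschetz`**
  (`Σ_u 𝐛(u) = 𝐚(v) + 𝐚(−v) + 2`, from `𝐣(w) + 𝐣(−w) = p`: `val_add_val_neg`).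
* §5 DEFINITION 1.1 / REMARK 1.2 (ii): `val_le_half_iff_not_val_neg_le_half` (for `p` odd exactly one of `h, −h` has
  `𝐣 ≤ (p−1)/2`) and **`natCard_admissible_eq`**: `#{f : G → ℕ | f(h) + f(−h) = r ∀ h} = (r + 1)^{(p−1)/2}` («The number of
  admissible functions (for given `g` and `p`) is obviously `(2g/(p−1) + 1)^{(p−1)/2}`»).
* §4 (namespace `…HodgeTheory.AbelianVariety`) THE ANALYTIC TYPE: for `δ : A ⟶ A` with `Φ_p(δ) = 0` and `ζ` primitive,
  `trace_lieMap_eq_sum_units` (Lemma 1.9 in `G`-indexing: `Tr_a(δ) = Σ_{h∈G} n_{ζ^h}(δ) ζ^h`), `conj_trace_lieMap_eq_sum_units`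
  (`τ̄ = Σ_h n_{ζ^h}(δ) ζ^{−h}`), `sum_units_eigenMultiplicity_eq_dim` ((1.2): `Σ_{h∈G} 𝐚(h) = g`),
  `add_eigenMultiplicity_neg_mul_eq` ((1.3): `(𝐚(h) + 𝐚(−h))(p−1) = 2g`), and
  **`prime_mul_eigenMultiplicity_add_one_eq_sum_of_lefschetz`**: if `1 − τ̄ = Σ_u 𝐛(u)/(1 − ζ^u)` for some `𝐛 : G → ℕ`
  then `p · (n_{ζ^v}(δ) + 1) = Σ_u 𝐛(u) 𝐣(u⁻¹(−v))` for all `v`, with **`sum_eq_of_lefschetz`**: `(Σ_u 𝐛(u))(p−1) = 2g + 2(p−1)`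
  (= Corollary 1.8's `F(φ) = 2g/(p−1) + 2`, recovered from the multiplicities alone).

## References

* [Zarhin2021PrimeOrderJacobians] Yu. G. Zarhin, Math. Research Reports (2021), arXiv:2109.06794, §1 Thm. 1.4, Cor. 1.8,
  Def. 1.1, Rem. 1.2 (ii), Lemma 1.9, Lemma 1.10, Prop. 1.11 with proof, Rem. 1.12 (chunks p0003–p0005).
* [AtiyahBott1968] M. F. Atiyah, R. Bott, *A Lefschetz fixed point formula for elliptic complexes II*, Ann. of Math. 88 (1968)
  — Zarhin's reference [AT] for the holomorphic Lefschetz formula `1 − τ̄ = Σ_P 1/(1 − ε_P)`, the hypothesis `hL` of §3–§4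
  (not proved here).
-/

noncomputable section

open Polynomial

namespace Literature.AlgebraicGeometry.HodgeTheory

namespace PrimeOrderRotation

/-! ## §1 Lemma 1.10: `1/(1 − ζ) = −(Σ_{j=1}^{p−1} j ζ^j)/p` -/

section Lemma110

variable {K : Type*} [Field K]

/-- **Lemma 1.10, telescoped: `(1 − ζ)(Σ_{j<n} j ζ^j) = −n`** for `ζ^n = 1`, `ζ ≠ 1` («`(1−ζ)(Σ_{j=1}^{p−1} j ζ^j) =
Σ (j ζ^j − j ζ^{j+1}) = (Σ_{j=1}^{p−1} ζ^j) − (p−1)ζ^p = (−1) − (p−1) = −p`»; the `j = 0` term is `0`).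
[cite: Zarhin2021PrimeOrderJacobians, §1 Lemma 1.10 (chunk p0004 L82–L95)] -/
theorem one_sub_mul_sum_range_natCast_mul_pow {ζ : K} {n : ℕ} (hn : ζ ^ n = 1) (h1 : ζ ≠ 1) :
    (1 - ζ) * ∑ j ∈ Finset.range n, (j : K) * ζ ^ j = -n := by
  have hg : ∑ j ∈ Finset.range n, ζ ^ j = 0 := by
    rw [geom_sum_eq h1, hn, sub_self, zero_div]
  have h2 : ζ * ∑ j ∈ Finset.range n, (j : K) * ζ ^ j =
      ∑ j ∈ Finset.range n, ((j + 1 : ℕ) : K) * ζ ^ (j + 1) - ζ * ∑ j ∈ Finset.range n, ζ ^ j := by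
    rw [Finset.mul_sum, Finset.mul_sum, ← Finset.sum_sub_distrib]
    refine Finset.sum_congr rfl fun j _ ↦ ?_
    push_cast
    ring
  have h3 := Finset.sum_range_succ' (fun j ↦ (j : K) * ζ ^ j) n
  rw [Finset.sum_range_succ, hn, mul_one, Nat.cast_zero, zero_mul, add_zero] at h3
  rw [hg, mul_zero, sub_zero, ← h3] at h2
  linear_combination -h2

/-- **Lemma 1.10 (Zarhin): `1/(1 − ζ) = −(Σ_{j<n} j ζ^j)/n`** for `ζ^n = 1`, `ζ ≠ 1`, `n ≠ 0` in `K` («Let `ζ ∈ ℂ` be a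
primitive `p`th root of unity. Then `1/(1−ζ) = −(Σ_{j=1}^{p−1} j ζ^j)/p = −(Σ_{h∈G} 𝐣(h) ζ^h)/p`»).
[cite: Zarhin2021PrimeOrderJacobians, §1 Lemma 1.10 (chunk p0004 L82–L95)] -/
theorem inv_one_sub_eq_neg_sum_div {ζ : K} {n : ℕ} (hn : ζ ^ n = 1) (h1 : ζ ≠ 1) (hn0 : (n : K) ≠ 0) :
    (1 - ζ)⁻¹ = -(∑ j ∈ Finset.range n, (j : K) * ζ ^ j) / n := by
  have h := one_sub_mul_sum_range_natCast_mul_pow hn h1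
  have h1' : (1 - ζ) ≠ 0 := sub_ne_zero.2 (Ne.symm h1)
  rw [eq_div_iff hn0]
  apply mul_left_cancel₀ h1'
  rw [← mul_assoc, mul_inv_cancel₀ h1', one_mul, mul_neg, h, neg_neg]

end Lemma110

/-! ## §2 The index group `G = (ℤ/pℤ)^*`: `ζ^v`, `ζ^{uv}`, `ζ^{−v}`, `Σ_v ζ^v = −1`, `ℚ`-linear independence of `{ζ^v}` -/

section Units

variable {K : Type*} [Field K] {p : ℕ} [hp : Fact p.Prime] {ζ : K}

omit hp in
/-- `ζ^{n mod p} = ζ^n` for a primitive `p`-th root. [cite: Zarhin2021PrimeOrderJacobians, §1 (chunk p0003 L106–L112)] -/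
theorem pow_mod_eq (hζ : IsPrimitiveRoot ζ p) (n : ℕ) : ζ ^ (n % p) = ζ ^ n := by
  have h := pow_mod_orderOf ζ n
  rwa [← hζ.eq_orderOf] at h

/-- `𝐣(v) ≠ 0`: a unit of `ℤ/pℤ` has a nonzero representative. [cite: Zarhin2021PrimeOrderJacobians, §1 (chunk p0003 L106–L108)] -/
theorem val_units_ne_zero (v : (ZMod p)ˣ) : (v : ZMod p).val ≠ 0 := by
  rw [Ne, ZMod.val_eq_zero]
  exact v.ne_zero

/-- **`ζ^{uv} = (ζ^u)^{𝐣(v)}`** («`𝐣(h₁h₂) ≡ 𝐣(h₁)𝐣(h₂) mod p`», and `ζ^p = 1`).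
[cite: Zarhin2021PrimeOrderJacobians, §1 (1.6) (chunk p0003 L110–L112)] -/
theorem pow_val_mul (hζ : IsPrimitiveRoot ζ p) (u v : (ZMod p)ˣ) :
    ζ ^ ((u * v : (ZMod p)ˣ) : ZMod p).val = (ζ ^ (u : ZMod p).val) ^ (v : ZMod p).val := by
  rw [Units.val_mul, ZMod.val_mul, pow_mod_eq hζ, pow_mul]

/-- **`ζ^{−v} = (ζ^v)⁻¹`** («If `h = j mod p` then `−h = (p−j) mod p`»). [cite: Zarhin2021PrimeOrderJacobians, §1 (chunk p0003 L64–L67)] -/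
theorem pow_val_neg (hζ : IsPrimitiveRoot ζ p) (v : (ZMod p)ˣ) :
    ζ ^ ((-v : (ZMod p)ˣ) : ZMod p).val = (ζ ^ (v : ZMod p).val)⁻¹ := by
  rw [Units.val_neg, ZMod.neg_val, if_neg v.ne_zero]
  exact eq_inv_of_mul_eq_one_left (by rw [← pow_add, Nat.sub_add_cancel (ZMod.val_lt _).le, hζ.pow_eq_one])

/-- `ζ^v` is again a primitive `p`-th root for `v ∈ G` («every `ε_P` is a (primitive) `p`th root of unity»; `𝐣(v)` is prime
to `p`). [cite: Zarhin2021PrimeOrderJacobians, §1 (chunk p0004 L103–L105)] -/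
theorem isPrimitiveRoot_pow_val (hζ : IsPrimitiveRoot ζ p) (v : (ZMod p)ˣ) :
    IsPrimitiveRoot (ζ ^ (v : ZMod p).val) p :=
  hζ.pow_of_coprime _ (ZMod.val_coe_unit_coprime v)

/-- `ζ^v ≠ 1` for `v ∈ G`. [cite: Zarhin2021PrimeOrderJacobians, §1 Lemma 1.5 / (chunk p0004 L103–L105)] -/
theorem pow_val_ne_one (hζ : IsPrimitiveRoot ζ p) (v : (ZMod p)ˣ) : ζ ^ (v : ZMod p).val ≠ 1 :=
  (isPrimitiveRoot_pow_val hζ v).ne_one hp.out.one_lt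

/-- **Re-indexing by `𝐣`: `Σ_{v ∈ G} f(𝐣(v)) = Σ_{j=1}^{p−1} f(j)`** («`𝐣 : G = (ℤ/pℤ)^* → ℤ`, `(j mod p) ↦ j`
(`1 ≤ j ≤ p−1`)» is a bijection onto `{1, …, p−1}`). [cite: Zarhin2021PrimeOrderJacobians, §1 (1.5) (chunk p0003 L106–L108)] -/
theorem sum_units_eq_sum_Ico {M : Type*} [AddCommMonoid M] (f : ℕ → M) :
    ∑ v : (ZMod p)ˣ, f (v : ZMod p).val = ∑ j ∈ Finset.Ico 1 p, f j := by
  refine Finset.sum_bij' (fun v _ ↦ (v : ZMod p).val)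
    (fun j hj ↦ ZMod.unitOfCoprime j
      (Nat.coprime_of_lt_prime (Nat.one_le_iff_ne_zero.1 (Finset.mem_Ico.1 hj).1) (Finset.mem_Ico.1 hj).2 hp.out).symm)
    (fun v _ ↦ Finset.mem_Ico.2 ⟨Nat.pos_of_ne_zero (val_units_ne_zero v), ZMod.val_lt _⟩)
    (fun j _ ↦ Finset.mem_univ _) (fun v _ ↦ ?_) (fun j hj ↦ ?_) (fun v _ ↦ rfl)
  · exact Units.ext (by rw [ZMod.coe_unitOfCoprime, ZMod.natCast_zmod_val])
  · rw [ZMod.coe_unitOfCoprime, ZMod.val_natCast, Nat.mod_eq_of_lt (Finset.mem_Ico.1 hj).2]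

/-- **`Σ_{v ∈ G} ζ^v = −1`** («`0 = 1 + Σ_{j=1}^{p−1} ζ_p^j = 1 + Σ_{v∈G} ζ_p^v`»).
[cite: Zarhin2021PrimeOrderJacobians, §1 proof of Prop. 1.11 (chunk p0004 L141–L144)] -/
theorem sum_pow_val_eq_neg_one (hζ : IsPrimitiveRoot ζ p) : ∑ v : (ZMod p)ˣ, ζ ^ (v : ZMod p).val = -1 := by
  rw [show (∑ v : (ZMod p)ˣ, ζ ^ (v : ZMod p).val) = ∑ j ∈ Finset.Ico 1 p, ζ ^ j from
    sum_units_eq_sum_Ico (fun j ↦ ζ ^ j)]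
  have h := hζ.geom_sum_eq_zero hp.out.one_lt
  rw [Finset.sum_range_eq_add_Ico _ hp.out.pos, pow_zero] at h
  linear_combination h

/-- **`{ζ_p^v | v ∈ G}` is `ℚ`-linearly independent** («the `(p−1)`-element set `{ζ_p^j | 1 ≤ j ≤ p−1} = {ζ_p^v | v ∈ G}` is a
basis of the `ℚ`-vector space `ℚ(ζ_p)`»: `Φ_p = minpoly_ℚ(ζ)` has degree `p − 1`, so `1, ζ, …, ζ^{p−2}` are independent, and
`ζ^v = ζ · ζ^{𝐣(v)−1}`; Mathlib: `cyclotomic_eq_minpoly_rat`, `linearIndependent_pow`).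
[cite: Zarhin2021PrimeOrderJacobians, §1 proof of Prop. 1.11 (chunk p0004 L148–L152)] -/
theorem eq_zero_of_sum_ratCast_mul_pow_val_eq_zero [CharZero K] (hζ : IsPrimitiveRoot ζ p) (c : (ZMod p)ˣ → ℚ)
    (h : ∑ v : (ZMod p)ˣ, (c v : K) * ζ ^ (v : ZMod p).val = 0) (v : (ZMod p)ˣ) : c v = 0 := by
  have hdeg : (minpoly ℚ ζ).natDegree = p - 1 := by
    rw [← cyclotomic_eq_minpoly_rat hζ hp.out.pos, natDegree_cyclotomic, Nat.totient_prime hp.out]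
  have hbound : ∀ w : (ZMod p)ˣ, (w : ZMod p).val - 1 < (minpoly ℚ ζ).natDegree := fun w ↦ by
    rw [hdeg]
    have h1 := ZMod.val_lt (w : ZMod p)
    have h2 := val_units_ne_zero w
    omega
  have hg : Function.Injective
      (fun w : (ZMod p)ˣ ↦ (⟨(w : ZMod p).val - 1, hbound w⟩ : Fin (minpoly ℚ ζ).natDegree)) := by
    intro u w huw
    have h1 : (u : ZMod p).val - 1 = (w : ZMod p).val - 1 := by simpa only [Fin.mk.injEq] using huw
    have h2 := val_units_ne_zero u
    have h3 := val_units_ne_zero w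
    exact Units.ext (ZMod.val_injective p (by omega))
  have hLI := (linearIndependent_pow (K := ℚ) ζ).comp _ hg
  rw [Fintype.linearIndependent_iff] at hLI
  have hζ0 : ζ ≠ 0 := hζ.ne_zero hp.out.ne_zero
  refine hLI c ?_ v
  apply mul_right_cancel₀ hζ0
  rw [zero_mul, Finset.sum_mul, ← h]
  refine Finset.sum_congr rfl fun w _ ↦ ?_
  simp only [Function.comp_apply, Rat.smul_def]
  rw [mul_assoc, ← pow_succ, Nat.sub_add_cancel (Nat.one_le_iff_ne_zero.2 (val_units_ne_zero w))]

/-- `𝐣(w) + 𝐣(−w) = p` for `w ∈ G` («If `h = j mod p` then `−h = (p−j) mod p`»).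
[cite: Zarhin2021PrimeOrderJacobians, §1 (chunk p0003 L64–L67)] -/
theorem val_add_val_neg (w : (ZMod p)ˣ) : (w : ZMod p).val + ((-w : (ZMod p)ˣ) : ZMod p).val = p := by
  rw [Units.val_neg, ZMod.neg_val, if_neg w.ne_zero, Nat.add_sub_cancel' (ZMod.val_lt _).le]

end Units

/-! ## §3 Proposition 1.11: from the Lefschetz identity to `𝐚(v) = ((p−1)/p) · (𝐛 ∗ 𝐣)(−v) − 1` -/

section Deduction

variable {K : Type*} [Field K] [CharZero K] {p : ℕ} [hp : Fact p.Prime] {ζ : K}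

/-- **Proposition 1.11 / Theorem 1.4 (the deduction): `p · (𝐚(v) + 1) = Σ_{u ∈ G} 𝐛(u) 𝐣(u⁻¹(−v))` for every `v ∈ G`**,
for ANY two functions `𝐚, 𝐛 : G → ℚ` bound by the Lefschetz identity `1 − Σ_h 𝐚(h) ζ^{−h} = Σ_u 𝐛(u)/(1 − ζ^u)`
(«`1 − Σ_{h∈G} 𝐚(h) ζ_p^{−h} = Σ_{u∈G} 𝐛(u)/(1 − ζ_p^u) = (−1/p) Σ_{v∈G} (Σ_{u∈G} 𝐛(u) 𝐣(u⁻¹v)) ζ_p^v` (here we use a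
substitution `v = hu`) […] `0 = 1 + Σ_{v∈G} ζ_p^v` […] `{ζ_p^v | v ∈ G}` is a basis of the `ℚ`-vector space `ℚ(ζ_p)`, we get
`1 + 𝐚(−v) = (p−1) 𝐛 ∗ 𝐣(v)/p`»; `(p−1) · (𝐛 ∗ 𝐣)(v) = Σ_u 𝐛(u) 𝐣(u⁻¹v)`).
[cite: Zarhin2021PrimeOrderJacobians, §1 Prop. 1.11 with proof (chunk p0004 L113–L152)] -/
theorem prime_mul_add_one_eq_sum_of_lefschetz (hζ : IsPrimitiveRoot ζ p) (a b : (ZMod p)ˣ → ℚ)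
    (hL : 1 - ∑ h : (ZMod p)ˣ, (a h : K) * ζ ^ ((-h : (ZMod p)ˣ) : ZMod p).val =
      ∑ u : (ZMod p)ˣ, (b u : K) / (1 - ζ ^ (u : ZMod p).val)) (v : (ZMod p)ˣ) :
    (p : ℚ) * (a v + 1) = ∑ u : (ZMod p)ˣ, b u * (((u⁻¹ * -v : (ZMod p)ˣ) : ZMod p).val : ℚ) := by
  have hp0 : (p : K) ≠ 0 := Nat.cast_ne_zero.2 hp.out.ne_zero
  have hpQ : (p : ℚ) ≠ 0 := Nat.cast_ne_zero.2 hp.out.ne_zero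
  -- Lemma 1.10 at `ζ^u` and the substitution `v = hu`
  have hR : ∀ u : (ZMod p)ˣ, (b u : K) / (1 - ζ ^ (u : ZMod p).val) = (b u : K) *
      (-(∑ w : (ZMod p)ˣ, (((u⁻¹ * w : (ZMod p)ˣ) : ZMod p).val : K) * ζ ^ (w : ZMod p).val) / p) := by
    intro u
    have h110 := inv_one_sub_eq_neg_sum_div (isPrimitiveRoot_pow_val hζ u).pow_eq_one (pow_val_ne_one hζ u) hp0
    have hIco : ∑ j ∈ Finset.range p, (j : K) * (ζ ^ (u : ZMod p).val) ^ j =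
        ∑ w : (ZMod p)ˣ, (((u⁻¹ * w : (ZMod p)ˣ) : ZMod p).val : K) * ζ ^ (w : ZMod p).val := by
      rw [Finset.sum_range_eq_add_Ico _ hp.out.pos, Nat.cast_zero, zero_mul, zero_add,
        ← show (∑ h : (ZMod p)ˣ, ((h : ZMod p).val : K) * (ζ ^ (u : ZMod p).val) ^ (h : ZMod p).val) =
            ∑ j ∈ Finset.Ico 1 p, (j : K) * (ζ ^ (u : ZMod p).val) ^ j from
          sum_units_eq_sum_Ico (fun j ↦ (j : K) * (ζ ^ (u : ZMod p).val) ^ j)]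
      refine Fintype.sum_equiv (Equiv.mulLeft u) _ _ fun h ↦ ?_
      simp only [Equiv.coe_mulLeft, inv_mul_cancel_left]
      congr 1
      exact (pow_val_mul hζ u h).symm
    rw [div_eq_mul_inv, h110, hIco]
  have hRS : ∑ u : (ZMod p)ˣ, (b u : K) / (1 - ζ ^ (u : ZMod p).val) =
      -(∑ w : (ZMod p)ˣ, (∑ u : (ZMod p)ˣ, (b u : K) * (((u⁻¹ * w : (ZMod p)ˣ) : ZMod p).val : K)) *
        ζ ^ (w : ZMod p).val) / p := by
    rw [Finset.sum_congr rfl fun u _ ↦ hR u]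
    have h1 : ∀ u : (ZMod p)ˣ, (b u : K) *
        (-(∑ w : (ZMod p)ˣ, (((u⁻¹ * w : (ZMod p)ˣ) : ZMod p).val : K) * ζ ^ (w : ZMod p).val) / p) =
        ∑ w : (ZMod p)ˣ, (b u : K) * (-1 / p) * ((((u⁻¹ * w : (ZMod p)ˣ) : ZMod p).val : K) * ζ ^ (w : ZMod p).val) := by
      intro u
      rw [← Finset.mul_sum]
      ring
    have h2 : -(∑ w : (ZMod p)ˣ, (∑ u : (ZMod p)ˣ, (b u : K) * (((u⁻¹ * w : (ZMod p)ˣ) : ZMod p).val : K)) *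
        ζ ^ (w : ZMod p).val) / (p : K) =
        ∑ w : (ZMod p)ˣ, -((∑ u : (ZMod p)ˣ, (b u : K) * (((u⁻¹ * w : (ZMod p)ˣ) : ZMod p).val : K)) *
          ζ ^ (w : ZMod p).val / p) := by
      rw [neg_div, Finset.sum_div, ← Finset.sum_neg_distrib]
    rw [Finset.sum_congr rfl fun u _ ↦ h1 u, Finset.sum_comm, h2]
    refine Finset.sum_congr rfl fun w _ ↦ ?_
    rw [Finset.sum_mul, Finset.sum_div, ← Finset.sum_neg_distrib]
    exact Finset.sum_congr rfl fun u _ ↦ by ring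
  -- the substitution `h = −w` on the left
  have hL1 : ∑ h : (ZMod p)ˣ, (a h : K) * ζ ^ ((-h : (ZMod p)ˣ) : ZMod p).val =
      ∑ w : (ZMod p)ˣ, (a (-w) : K) * ζ ^ (w : ZMod p).val :=
    Fintype.sum_equiv (Equiv.neg _) _ _ fun h ↦ by rw [Equiv.neg_apply, neg_neg]
  have hS := sum_pow_val_eq_neg_one hζ
  -- the rational coefficient vector that must vanish
  let c : (ZMod p)ˣ → ℚ := fun w ↦
    -1 - a (-w) + (∑ u : (ZMod p)ˣ, b u * (((u⁻¹ * w : (ZMod p)ˣ) : ZMod p).val : ℚ)) / p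
  have hc : ∑ w : (ZMod p)ˣ, (c w : K) * ζ ^ (w : ZMod p).val = 0 := by
    have hsplit : ∑ w : (ZMod p)ˣ, (c w : K) * ζ ^ (w : ZMod p).val =
        -(∑ w : (ZMod p)ˣ, ζ ^ (w : ZMod p).val) - (∑ w : (ZMod p)ˣ, (a (-w) : K) * ζ ^ (w : ZMod p).val) +
          (∑ w : (ZMod p)ˣ, (∑ u : (ZMod p)ˣ, (b u : K) * (((u⁻¹ * w : (ZMod p)ˣ) : ZMod p).val : K)) *
            ζ ^ (w : ZMod p).val) / p := by
      rw [Finset.sum_div, ← Finset.sum_neg_distrib, ← Finset.sum_sub_distrib, ← Finset.sum_add_distrib]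
      refine Finset.sum_congr rfl fun w _ ↦ ?_
      simp only [c]
      push_cast
      ring
    rw [hsplit, ← hL1, hS]
    linear_combination hL + hRS
  have hcv := eq_zero_of_sum_ratCast_mul_pow_val_eq_zero hζ c hc (-v)
  simp only [c, neg_neg] at hcv
  have h2 : (∑ u : (ZMod p)ˣ, b u * (((u⁻¹ * -v : (ZMod p)ˣ) : ZMod p).val : ℚ)) / p = 1 + a v := by
    linear_combination hcv
  rw [div_eq_iff hpQ] at h2
  linear_combination -h2

/-- **Theorem 1.4 / Proposition 1.11 as printed: `𝐚(v) = ((p−1)/p) · (𝐛 ∗ 𝐣)(−v) − 1`** with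
`(𝐛 ∗ 𝐣)(h) = (1/(p−1)) Σ_{u∈G} 𝐛(u) 𝐣(u⁻¹h)` («`𝐚(v) = ((p−1)/p) · 𝐛 ∗ 𝐣(−v) − 1 ∀ v ∈ G`»), under the Lefschetz identity.
[cite: Zarhin2021PrimeOrderJacobians, §1 Thm. 1.4 (1.9), Prop. 1.11 (1.12) (chunk p0003 L131–L147, p0004 L113–L152)] -/
theorem eq_convolution_sub_one_of_lefschetz (hζ : IsPrimitiveRoot ζ p) (a b : (ZMod p)ˣ → ℚ)
    (hL : 1 - ∑ h : (ZMod p)ˣ, (a h : K) * ζ ^ ((-h : (ZMod p)ˣ) : ZMod p).val =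
      ∑ u : (ZMod p)ˣ, (b u : K) / (1 - ζ ^ (u : ZMod p).val)) (v : (ZMod p)ˣ) :
    a v = (p - 1) / p *
      ((1 / (p - 1)) * ∑ u : (ZMod p)ˣ, b u * (((u⁻¹ * -v : (ZMod p)ˣ) : ZMod p).val : ℚ)) - 1 := by
  have h := prime_mul_add_one_eq_sum_of_lefschetz hζ a b hL v
  have hpQ : (p : ℚ) ≠ 0 := Nat.cast_ne_zero.2 hp.out.ne_zero
  have hp1 : (p : ℚ) - 1 ≠ 0 := by
    rw [sub_ne_zero]
    exact_mod_cast hp.out.one_lt.ne'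
  set S := ∑ u : (ZMod p)ˣ, b u * (((u⁻¹ * -v : (ZMod p)ˣ) : ZMod p).val : ℚ) with hSdef
  have hS : ((p : ℚ) - 1) / p * (1 / (p - 1) * S) = S / p := by
    rw [← mul_assoc, div_mul_div_comm, mul_one, mul_comm (p : ℚ) _, div_mul_eq_div_div, div_self hp1,
      one_div_mul_eq_div]
  rw [hS, eq_sub_iff_add_eq, eq_div_iff hpQ]
  linear_combination h

/-- **Proposition 1.11 for nonnegative-integer-valued `𝐚, 𝐛`** (Zarhin's setting «`𝐛 : G → ℤ_+`»): the identity
`p · (𝐚(v) + 1) = Σ_u 𝐛(u) 𝐣(u⁻¹(−v))` holds in `ℕ`. [cite: Zarhin2021PrimeOrderJacobians, §1 Prop. 1.11 (chunk p0004 L113–L152)] -/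
theorem prime_mul_add_one_eq_sum_of_lefschetz_nat (hζ : IsPrimitiveRoot ζ p) (a b : (ZMod p)ˣ → ℕ)
    (hL : 1 - ∑ h : (ZMod p)ˣ, (a h : K) * ζ ^ ((-h : (ZMod p)ˣ) : ZMod p).val =
      ∑ u : (ZMod p)ˣ, (b u : K) / (1 - ζ ^ (u : ZMod p).val)) (v : (ZMod p)ˣ) :
    p * (a v + 1) = ∑ u : (ZMod p)ˣ, b u * ((u⁻¹ * -v : (ZMod p)ˣ) : ZMod p).val := by
  have h := prime_mul_add_one_eq_sum_of_lefschetz hζ (fun h ↦ (a h : ℚ)) (fun u ↦ (b u : ℚ))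
    (by simpa only [Rat.cast_natCast] using hL) v
  exact_mod_cast h

/-- **The count is forced: `Σ_{u ∈ G} 𝐛(u) = 𝐚(v) + 𝐚(−v) + 2`** for every `v`, whenever `𝐚, 𝐛` are bound by the Lefschetz
identity — adding the instances `v` and `−v` of Proposition 1.11 and using `𝐣(w) + 𝐣(−w) = p` (Zarhin obtains
`Σ_h 𝐛(h) = F(φ) = 2g/(p−1) + 2` from Riemann–Hurwitz, Corollary 1.8, and checks the converse direction in Remark 1.12:
«This implies that `𝐚(v) + 𝐚(−v) = 2g/(p−1)`. (Actually, we already know it.)»).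
[cite: Zarhin2021PrimeOrderJacobians, §1 Cor. 1.8, Prop. 1.11 (1.11), Rem. 1.12 (chunk p0004 L44–L52, L113–L121; p0005 L1–L35)] -/
theorem sum_eq_add_add_two_of_lefschetz (hζ : IsPrimitiveRoot ζ p) (a b : (ZMod p)ˣ → ℚ)
    (hL : 1 - ∑ h : (ZMod p)ˣ, (a h : K) * ζ ^ ((-h : (ZMod p)ˣ) : ZMod p).val =
      ∑ u : (ZMod p)ˣ, (b u : K) / (1 - ζ ^ (u : ZMod p).val)) (v : (ZMod p)ˣ) :
    ∑ u : (ZMod p)ˣ, b u = a v + a (-v) + 2 := by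
  have h1 := prime_mul_add_one_eq_sum_of_lefschetz hζ a b hL v
  have h2 := prime_mul_add_one_eq_sum_of_lefschetz hζ a b hL (-v)
  have hpQ : (p : ℚ) ≠ 0 := Nat.cast_ne_zero.2 hp.out.ne_zero
  have hsum : ∑ u : (ZMod p)ˣ, b u * (((u⁻¹ * -v : (ZMod p)ˣ) : ZMod p).val : ℚ) +
      ∑ u : (ZMod p)ˣ, b u * (((u⁻¹ * - -v : (ZMod p)ˣ) : ZMod p).val : ℚ) = p * ∑ u : (ZMod p)ˣ, b u := by
    rw [← Finset.sum_add_distrib, Finset.mul_sum]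
    refine Finset.sum_congr rfl fun u _ ↦ ?_
    rw [neg_neg, ← mul_add, ← Nat.cast_add, mul_neg, add_comm, val_add_val_neg, mul_comm]
  apply mul_left_cancel₀ hpQ
  linear_combination -h1 - h2 - hsum

end Deduction

/-! ## §5 Definition 1.1 / Remark 1.2 (ii): there are `(r + 1)^{(p−1)/2}` admissible functions `f(h) + f(−h) = r` -/

section Admissible

variable {p : ℕ} [hp : Fact p.Prime]

/-- For an odd prime `p`, exactly one of `h, −h ∈ G` has its representative `𝐣` in `{1, …, (p−1)/2}` («If `h = j mod p` then
`−h = (p−j) mod p`»; `−1 mod p` is «the only element of order 2»). [cite: Zarhin2021PrimeOrderJacobians, §1 (chunk p0003 L64–L67)] -/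
theorem val_le_half_iff_not_val_neg_le_half (hodd : p ≠ 2) (h : (ZMod p)ˣ) :
    (h : ZMod p).val ≤ (p - 1) / 2 ↔ ¬ ((-h : (ZMod p)ˣ) : ZMod p).val ≤ (p - 1) / 2 := by
  obtain ⟨k, hk⟩ := hp.out.odd_of_ne_two hodd
  have hsum := val_add_val_neg h
  have h0 := val_units_ne_zero h
  have h0' := val_units_ne_zero (-h)
  omega

/-- **Remark 1.2 (ii) (Zarhin): the number of admissible functions is `(2g/(p−1) + 1)^{(p−1)/2}`** — for an odd prime `p` and
any `r` («`2g/(p−1)`»), the functions `f : G = (ℤ/pℤ)^* → ℤ_+` with `f(h) + f(−h) = r` for all `h` (Definition 1.1: «We say that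
`f` is admissible if `𝐚(h) + 𝐚(−h) = 2g/(p−1) ∀ h ∈ G`») number exactly `(r + 1)^{(p−1)/2}`: such an `f` is its restriction
to the half system `{h : 𝐣(h) ≤ (p−1)/2}` of representatives of `G/{±1}`, which is arbitrary with values in `{0, …, r}`
(«The number of admissible functions (for given `g` and `p`) is obviously `(2g/(p−1) + 1)^{(p−1)/2}`»).
[cite: Zarhin2021PrimeOrderJacobians, §1 Def. 1.1, Rem. 1.2 (ii) (chunk p0003 L74–L89)] -/
theorem natCard_admissible_eq (hodd : p ≠ 2) (r : ℕ) :
    Nat.card {f : (ZMod p)ˣ → ℕ // ∀ h, f h + f (-h) = r} = (r + 1) ^ ((p - 1) / 2) := by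
  have hmem := val_le_half_iff_not_val_neg_le_half hodd (hp := hp)
  have hneg : ∀ h : (ZMod p)ˣ, ¬ (h : ZMod p).val ≤ (p - 1) / 2 → ((-h : (ZMod p)ˣ) : ZMod p).val ≤ (p - 1) / 2 :=
    fun h hh ↦ (hmem (-h)).2 (by rw [neg_neg]; exact hh)
  let e : {f : (ZMod p)ˣ → ℕ // ∀ h, f h + f (-h) = r} ≃
      ({h : (ZMod p)ˣ // (h : ZMod p).val ≤ (p - 1) / 2} → Fin (r + 1)) :=
    { toFun := fun f s ↦ ⟨f.1 s.1, by have h1 := f.2 s.1; omega⟩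
      invFun := fun g ↦ ⟨fun h ↦ if hh : (h : ZMod p).val ≤ (p - 1) / 2 then (g ⟨h, hh⟩ : ℕ)
          else r - (g ⟨-h, hneg h hh⟩ : ℕ), fun h ↦ by
        have hg : ∀ (h1 : ((- -h : (ZMod p)ˣ) : ZMod p).val ≤ (p - 1) / 2) (h2 : (h : ZMod p).val ≤ (p - 1) / 2),
            g ⟨- -h, h1⟩ = g ⟨h, h2⟩ := fun h1 h2 ↦ by
          congr 1
          exact Subtype.ext (neg_neg h)
        dsimp only
        by_cases hh : (h : ZMod p).val ≤ (p - 1) / 2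
        · have hn : ¬ ((-h : (ZMod p)ˣ) : ZMod p).val ≤ (p - 1) / 2 := (hmem h).1 hh
          rw [dif_pos hh, dif_neg hn, hg (hneg (-h) hn) hh]
          have h1 := (g ⟨h, hh⟩).isLt
          omega
        · have hy := hneg h hh
          rw [dif_neg hh, dif_pos hy]
          have h1 := (g ⟨-h, hy⟩).isLt
          omega⟩
      left_inv := fun f ↦ Subtype.ext (funext fun h ↦ by
        dsimp only
        split_ifs with hh
        · rfl
        · have h1 := f.2 h
          omega)
      right_inv := fun g ↦ funext fun s ↦ Fin.ext (by
        dsimp only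
        rw [dif_pos s.2]) }
  have hS : Fintype.card {h : (ZMod p)ˣ // (h : ZMod p).val ≤ (p - 1) / 2} = (p - 1) / 2 := by
    rw [Fintype.card_subtype, Finset.card_eq_sum_ones, Finset.sum_filter,
      show (∑ h : (ZMod p)ˣ, if (h : ZMod p).val ≤ (p - 1) / 2 then 1 else 0) =
          ∑ j ∈ Finset.Ico 1 p, if j ≤ (p - 1) / 2 then 1 else 0 from
        sum_units_eq_sum_Ico (fun j ↦ if j ≤ (p - 1) / 2 then 1 else 0),
      ← Finset.sum_filter, ← Finset.card_eq_sum_ones]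
    have hI : (Finset.Ico 1 p).filter (fun j ↦ j ≤ (p - 1) / 2) = Finset.Icc 1 ((p - 1) / 2) := by
      ext j
      simp only [Finset.mem_filter, Finset.mem_Ico, Finset.mem_Icc]
      have h1 := hp.out.one_lt
      omega
    rw [hI, Nat.card_Icc]
    omega
  rw [Nat.card_congr e, Nat.card_eq_fintype_card, Fintype.card_fun, Fintype.card_fin, hS]

end Admissible

end PrimeOrderRotation

/-! ## §4 The analytic type of `δ` with `Φ_p(δ) = 0`: `τ̄ = Σ_h n_{ζ^h}(δ) ζ^{−h}` and Zarhin's formula for `n_{ζ^v}(δ)` -/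

namespace AbelianVariety

open CategoryTheory PrimeOrderRotation

section AnalyticType

variable {A : Motives.AbelianVariety ℂ} {δ : A ⟶ A} {p : ℕ} [hp : Fact p.Prime] {ζ : ℂ}

/-- **Lemma 1.9 in `G`-indexing: `Tr_a(δ) = Σ_{h ∈ G} 𝐚(h) ζ^h`**, `𝐚(h) = n_{ζ^h}(δ)` («`τ = Σ_{j=1}^{p-1} a_j ζ_p^j =
Σ_{h∈G} 𝐚(h) ζ_p^h`»). [cite: Zarhin2021PrimeOrderJacobians, §1 Lemma 1.9 (chunk p0004 L55–L60)] -/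
theorem trace_lieMap_eq_sum_units (hδ : (cyclotomic p ℤ).eval₂ (Int.castRingHom (End A)) (End.of δ) = 0)
    (hζ : IsPrimitiveRoot ζ p) :
    LinearMap.trace ℂ (Motives.AbelianVariety.Lie A) (Motives.AbelianVariety.lieMap A δ) =
      ∑ h : (ZMod p)ˣ, (eigenMultiplicity A δ (ζ ^ (h : ZMod p).val) : ℂ) * ζ ^ (h : ZMod p).val := by
  rw [trace_lieMap_eq_sum_Ico_of_prime hδ hζ]
  exact (sum_units_eq_sum_Ico (fun j ↦ (eigenMultiplicity A δ (ζ ^ j) : ℂ) * ζ ^ j)).symm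

/-- **`τ̄ = Σ_{h ∈ G} 𝐚(h) ζ^{−h}`** — the complex conjugate of the trace («`1 − τ̄ = …` where `τ̄` is the complex-conjugate
of `τ`»; `ζ̄^h = ζ^{−h}` on the unit circle). [cite: Zarhin2021PrimeOrderJacobians, §1 (1.10), proof of Prop. 1.11 (chunk p0004 L97–L135)] -/
theorem conj_trace_lieMap_eq_sum_units (hδ : (cyclotomic p ℤ).eval₂ (Int.castRingHom (End A)) (End.of δ) = 0)
    (hζ : IsPrimitiveRoot ζ p) :
    starRingEnd ℂ (LinearMap.trace ℂ (Motives.AbelianVariety.Lie A) (Motives.AbelianVariety.lieMap A δ)) =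
      ∑ h : (ZMod p)ˣ, (eigenMultiplicity A δ (ζ ^ (h : ZMod p).val) : ℂ) * ζ ^ ((-h : (ZMod p)ˣ) : ZMod p).val := by
  rw [trace_lieMap_eq_sum_units hδ hζ, map_sum]
  refine Finset.sum_congr rfl fun h _ ↦ ?_
  rw [map_mul, map_natCast, pow_val_neg hζ,
    Complex.inv_eq_conj ((isPrimitiveRoot_pow_val hζ h).norm'_eq_one hp.out.ne_zero)]

/-- **Zarhin (1.2) in `G`-indexing: `Σ_{h ∈ G} 𝐚(h) = g`.** [cite: Zarhin2021PrimeOrderJacobians, §1 (1.2), (1.5) (chunk p0003 L47–L62)] -/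
theorem sum_units_eigenMultiplicity_eq_dim (hδ : (cyclotomic p ℤ).eval₂ (Int.castRingHom (End A)) (End.of δ) = 0)
    (hζ : IsPrimitiveRoot ζ p) :
    ∑ h : (ZMod p)ˣ, eigenMultiplicity A δ (ζ ^ (h : ZMod p).val) = A.dim := by
  rw [← sum_Ico_eigenMultiplicity_pow_eq_dim hδ hζ]
  exact sum_units_eq_sum_Ico (fun j ↦ eigenMultiplicity A δ (ζ ^ j))

/-- **Zarhin (1.3)/(1.8) in `G`-indexing: `(𝐚(h) + 𝐚(−h)) · (p − 1) = 2g`** («`𝐚_X(h) + 𝐚_X(−h) = 2g/(p−1) ∀ h ∈ G`»).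
[cite: Zarhin2021PrimeOrderJacobians, §1 (1.8), Def. 1.1, Rem. 1.2 (i) (chunk p0003 L68–L85)] -/
theorem add_eigenMultiplicity_neg_mul_eq (hδ : (cyclotomic p ℤ).eval₂ (Int.castRingHom (End A)) (End.of δ) = 0)
    (hζ : IsPrimitiveRoot ζ p) (h : (ZMod p)ˣ) :
    (eigenMultiplicity A δ (ζ ^ (h : ZMod p).val) + eigenMultiplicity A δ (ζ ^ ((-h : (ZMod p)ˣ) : ZMod p).val)) *
      (p - 1) = 2 * A.dim := by
  rw [pow_val_neg hζ, ← Nat.totient_prime hp.out]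
  exact add_eigenMultiplicity_inv_mul_totient_eq hp.out.pos hδ (isPrimitiveRoot_pow_val hζ h)

/-- **Zarhin's Theorem 1.4 / Proposition 1.11 for the analytic type: if `1 − τ̄ = Σ_{u∈G} 𝐛(u)/(1 − ζ^u)` (the holomorphic
Lefschetz identity, `τ = Tr_a(δ)`, `𝐛(u)` = number of fixed points with rotation number `ζ^u`), then
`p · (n_{ζ^v}(δ) + 1) = Σ_{u∈G} 𝐛(u) 𝐣(u⁻¹(−v))`, i.e. `𝐚(v) = ((p−1)/p) · (𝐛 ∗ 𝐣)(−v) − 1`, for every `v ∈ G`.**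
The Lefschetz identity itself ([AT], [GH]) is the hypothesis `hL`. [cite: Zarhin2021PrimeOrderJacobians, §1 Thm. 1.4, Prop. 1.11
with proof (chunk p0003 L131–L147, p0004 L97–L152)] [cite: AtiyahBott1968, via Zarhin2021PrimeOrderJacobians §1 (1.10) refs
[AT], [GH] (chunk p0008 L5–L9)] -/
theorem prime_mul_eigenMultiplicity_add_one_eq_sum_of_lefschetz
    (hδ : (cyclotomic p ℤ).eval₂ (Int.castRingHom (End A)) (End.of δ) = 0) (hζ : IsPrimitiveRoot ζ p)
    (b : (ZMod p)ˣ → ℕ)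
    (hL : 1 - starRingEnd ℂ (LinearMap.trace ℂ (Motives.AbelianVariety.Lie A) (Motives.AbelianVariety.lieMap A δ)) =
      ∑ u : (ZMod p)ˣ, (b u : ℂ) / (1 - ζ ^ (u : ZMod p).val)) (v : (ZMod p)ˣ) :
    p * (eigenMultiplicity A δ (ζ ^ (v : ZMod p).val) + 1) =
      ∑ u : (ZMod p)ˣ, b u * ((u⁻¹ * -v : (ZMod p)ˣ) : ZMod p).val := by
  rw [conj_trace_lieMap_eq_sum_units hδ hζ] at hL
  exact prime_mul_add_one_eq_sum_of_lefschetz_nat hζ (fun h ↦ eigenMultiplicity A δ (ζ ^ (h : ZMod p).val)) b hL v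

/-- **Corollary 1.8 recovered from the multiplicities: `(Σ_{u∈G} 𝐛(u)) · (p − 1) = 2g + 2(p − 1)`**, i.e.
`F(φ) = Σ_h 𝐛(h) = 2g/(p−1) + 2`, for any `𝐛 : G → ℕ` satisfying the Lefschetz identity with `τ = Tr_a(δ)` («The number
`F(φ)` of fixed points of `φ` is `2g/(p−1) + 2`»; here from `Σ_u 𝐛(u) = 𝐚(v) + 𝐚(−v) + 2` and (1.8)).
[cite: Zarhin2021PrimeOrderJacobians, §1 Cor. 1.8, Prop. 1.11 (1.11) (chunk p0004 L44–L52, L113–L121)] -/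
theorem sum_eq_of_lefschetz (hδ : (cyclotomic p ℤ).eval₂ (Int.castRingHom (End A)) (End.of δ) = 0)
    (hζ : IsPrimitiveRoot ζ p) (b : (ZMod p)ˣ → ℕ)
    (hL : 1 - starRingEnd ℂ (LinearMap.trace ℂ (Motives.AbelianVariety.Lie A) (Motives.AbelianVariety.lieMap A δ)) =
      ∑ u : (ZMod p)ˣ, (b u : ℂ) / (1 - ζ ^ (u : ZMod p).val)) :
    (∑ u : (ZMod p)ˣ, b u) * (p - 1) = 2 * A.dim + 2 * (p - 1) := by
  rw [conj_trace_lieMap_eq_sum_units hδ hζ] at hL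
  have h := sum_eq_add_add_two_of_lefschetz hζ (fun h ↦ (eigenMultiplicity A δ (ζ ^ (h : ZMod p).val) : ℚ))
    (fun u ↦ (b u : ℚ)) (by simpa only [Rat.cast_natCast] using hL) 1
  have h' : ∑ u : (ZMod p)ˣ, b u = eigenMultiplicity A δ (ζ ^ ((1 : (ZMod p)ˣ) : ZMod p).val) +
      eigenMultiplicity A δ (ζ ^ ((-1 : (ZMod p)ˣ) : ZMod p).val) + 2 := by
    exact_mod_cast h
  rw [h', add_mul, add_eigenMultiplicity_neg_mul_eq hδ hζ 1]

end AnalyticType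

end AbelianVariety

end Literature.AlgebraicGeometry.HodgeTheory

end
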